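import Summits.CriticalPhenomena.PercolationContinuityZ3.Theorems.Transplant.SkelPhiRootKits
import Summits.CriticalPhenomena.PercolationContinuityZ3.Theorems.Transplant.SkelPhiRootHop
import Summits.CriticalPhenomena.PercolationContinuityZ3.Theorems.Transplant.SkelPhiKitsStepI
import HarnessLib

/-!
# D″ node, (R) layer, file 6 (R-RECUT-PLAN §1 rows 5–7; DPRIME-SCOPE p3 addendum M / M.9 (3)): THE KIT CLAUSES AND THE FIRST-HOP LINK OF
# THE ROOT BAND RUN FROM THE STEP-I′ CERTIFICATE — `Skelφ.hkits_rootSched` (ONE call of p1-g9's `Skelφ.kitClause_stepI` per level, its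
# planar room from the schedule's `route` property via `WinChainData.roomS`, far contacts through the rim part) and `Skelφ.root_hsrc_stepI`
# (file 4's `root_hsrcSG` fed with p1-g9's `Skelφ.link_at_center` at the walk's end `c` over `x₀ = rootCtr du (ca − ℓ1) 0`: band rectangle
# of extent `ℓ1` along `du`, landing side-half on the start ROW `core 0 = {level = ca, |trans| ≤ q'}` of `RootRun2.rootSched`) — the φ-level
# successor of p2-g5's `SkelConcRootClauses` (`hkits_rootWAD` with seed-slab kits and quarter-face routes; `rootOblA_concSG_kits`)

builds on p205010 (kernel theorem, internal audit signed; external expert review pending) — nothing in this file uses p205010.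
Status sentence (coordinator 2026-08-20T04:30Z): "θ(p_c) = 0 on ℤ^d, all d ≥ 2 — kernel-verified (Lean 4/Mathlib, standard axioms); internal
adversarial audit SIGNED 2026-08-20 04:29Z; external expert review pending."
Lane `prim-bschramm-*`, seat `prim-bschramm-p2` (gen 8; (R) = p2 lineage under D″); helper file (`--supports stmt-CriticalPhenomena-4575`).

For every direction `du` (transverse centre `cb = 0`), every root step `k ≤ N` and every level `j ∈ [j₀, j₁]` of the window-chain data
`Pc = Skelφ.rootWCD … (rootSched P du h) … (rootUS …)` the per-level kit clause of `Skelφ.rootOblS_of_rootRunSG` (hypothesis `hkits`) is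
p1-g9's two-scale `kitClause_stepI` at the window step `(winGraph G w₀ Rt, levels B⟨j⟩ of core k, region D_k = Win w₀ (regionR k) Rt,
enlarged target T_k = Win w₀ (core (k+1)) Rt ∪ Rim_k)` under the cut root law `W0sub (rootUS …)`: far inner neighbours (deeper than `Rt − r₀`,
`r₀ ≤ L'`) lie in `Rim_k`; the planar room is the schedule's route property (`roomS`); the subbox / level facts are file 5's
`isSubbox_rootSched` and `Schedule.level_subset_region`; the cores `k ≥ 1` have zero axial width, so `T₀ = tanOff ℓs M ≤ j₀` makes the level
boxes `2 T₀` wide.  The first hop: the Step-I′ side input `(c, ℓ1, some (du.1, sgOf du, +1))` at the walk's end `c` over `x₀`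
(`σ x₀_a = ca − ℓ1`, `x₀_⊥ = 0`, `ℓ1 ≤ min ca (5 r∥)`): its seed `D.Λ c D.k = fatSeqOff off c D.k ⊆ Win w₀ (P.Q 0) R₀` (`ca − ℓ1 + D.k ≤ 5 r∥`, `D.k ≤ 5 r⊥`,
`5 r∥ + ψ(D.k) + off ≤ R₀`), its band rectangle inside the cut root world (levels `[ca − 2ℓ1, ca] ⊆ [−5 r∥, 25 r∥]`, `|trans| ≤ Wb ℓ1 ≤ q' ≤ 5 r⊥ − 1`,
depth `5 r∥ + R(ℓ1) ≤ Rp` with `Rp + 1 ≤ rQ 0 0, rB 0 0 du, rQ 0 (0+du)`, `Rp ≤ Rt`), its landing half on the start row.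
* §1 `RootRun2.mem_rootWorld_of_level` (a planar point with level in `[−5 r∥, 25 r∥]` and `|trans| ≤ 5 r⊥ − 1` lies in `Q 0 ∪ (BtwN 0 du ∪ Q (0+du))`),
  `Skelφ.Win_rootWorld_subset_rootUS (hstep)`;
* §2 **`Skelφ.hkits_rootSched`**;
* §3 **`Skelφ.root_hsrc_stepI`**.
[cite: KozmaNitzan2024, §4 Lemma 9 (p. 16), Lemma 10 Steps III–V (pp. 19–22), Lemma 11 (pp. 22–23), p. 28 ((32) at the root)]
-/

noncomputable section

open MeasureTheory ProbabilityTheory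
open scoped ENNReal Classical

namespace Summit.CriticalPhenomena.PercolationContinuityZ3.Theorems

namespace Transplant

/-! ## §1 Planar: the first-hop footprints in the root world -/

namespace RootRun2

open Literature.Probability.Percolation Literature.Probability.LatticeModels
open Literature.Probability.Percolation.KozmaNitzan
open Literature.Probability.Percolation.KozmaNitzan.Cells (oth oth_ne eq_oth_of_ne sgOf sgOf_sign stepVec_apply_fst stepVec_apply_oth)
open ChainPlanar
open BoxProdZ2 (rootCtr rootCtr_fst rootCtr_oth)

/-- **A planar point with level `σ x_a ∈ [−5 r∥, 25 r∥]` and `|x_⊥| ≤ 5 r⊥ − 1` lies in the root world** `Q 0 ∪ (BtwN 0 du ∪ Q (0 + du))`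
(below level `5 r∥` in `Q 0`, above in the narrow between-box or the child's cube). [cite: KozmaNitzan2024, §4 p. 26 (Q_v, E_{v,x})] -/
theorem mem_rootWorld_of_level (P : PCells2) (du : MDir) {x : Site 2} (hlo : -(5 * (P.r du.1 : ℤ)) ≤ sgOf du * x du.1)
    (hhi : sgOf du * x du.1 ≤ 25 * (P.r du.1 : ℤ)) (htr : |x (oth du.1)| ≤ 5 * (P.r (oth du.1) : ℤ) - 1) :
    x ∈ P.Q 0 ∪ (P.BtwN 0 du ∪ P.Q ((0 : Site 2) + stepVec du)) := by
  have hab := abs_le.1 htr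
  by_cases hL : sgOf du * x du.1 ≤ 5 * (P.r du.1 : ℤ)
  · -- inside the root cube
    refine Finset.mem_union_left _ ?_
    rw [PCells2.Q, PCells2.mem_abox_iff]
    intro i
    simp only [PCells2.cen_zero, Pi.zero_apply]
    push_cast
    by_cases hi : i = du.1
    · subst hi; rcases sgOf_sign du with hs | hs <;> rw [hs] at hL hlo <;> constructor <;> linarith
    · rw [eq_oth_of_ne hi]; constructor <;> linarith [hab.1, hab.2]
  · -- above the root cube: a degenerate signed box about `rootCtr du (σ x_a) 0`
    push Not at hL
    refine Finset.mem_union_right _ (sBox_rootCtr_subset_BtwN_union_Q P du (sgOf du * x du.1) 0 (lo := 0) (hi := 0)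
      (w := |x (oth du.1)|) (by linarith) (by linarith) (by rw [abs_zero, zero_add]; exact htr) ?_)
    rw [PCells.mem_psBox_iff]
    simp only [rootCtr_fst, rootCtr_oth]
    have hσσ : sgOf du * sgOf du = 1 := by rcases sgOf_sign du with hs | hs <;> simp [hs]
    refine ⟨?_, ?_⟩
    · have : sgOf du * (x du.1 - sgOf du * (sgOf du * x du.1)) = 0 := by
        rw [mul_sub, ← mul_assoc, ← mul_assoc, hσσ, one_mul, sub_self]
      rw [this]; exact ⟨le_rfl, le_rfl⟩
    · constructor <;> linarith [le_abs_self (x (oth du.1)), neg_abs_le (x (oth du.1))]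

end RootRun2

namespace Skelφ

open Literature.Probability.Percolation Literature.Probability.LatticeModels SimpleGraph GadgetSystem ProbeHistory HSiteScheme Contour KNCells
open Literature.Probability.Percolation.KozmaNitzan
open Literature.Probability.Percolation.KozmaNitzan.Cells (oth oth_ne eq_oth_of_ne sgOf sgOf_sign)
open KNCells.KSchA KNLevels ChainPlanar
open Literature.Barriers.CriticalPhenomena (graphBall mem_graphBall_self graphBall_mono)
open BoxProdZ2 (ConcRadiiG rootCtr rootCtr_fst rootCtr_oth)
open Skel (winGraph)
open SkelI (tanOff)
open RootRun2 (RootBandOK rootSched rootSched_region_subset rootSched_region_disjoint_Q rootSched_core_zero mem_rootWorld_of_level)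

variable {V : Type} [DecidableEq V] {G : SimpleGraph V} [G.LocallyFinite] {φ : V → Site 2} {types : Finset V}
variable {P : PCells2} {w₀ : V} {Λ : ConcRadiiG} {q : unitInterval} {δc : ℝ} {Rt : ℕ} {du : MDir}
  {s₁ R' ℓ₀ N WM : ℕ} {Wb : ℕ → ℕ} {ca cb q' ρ : ℤ}

/-- **The window of depth `Rp` over the planar root world lies in the cut root world** `rootUS … Rt du` once `Rp + 1 ≤ rQ 0 0`,
`Rp + 1 ≤ rB 0 0 du`, `Rp + 1 ≤ rQ 0 (0 + du)` and `Rp ≤ Rt` (step device into the three spans). [folklore] -/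
theorem Win_rootWorld_subset_rootUS (hstep : Steps G φ) {Rp : ℕ} (hQ0 : Rp + 1 ≤ Λ.rQ 0 0) (hB : Rp + 1 ≤ Λ.rB 0 0 du)
    (hQ1 : Rp + 1 ≤ Λ.rQ 0 ((0 : Site 2) + stepVec du)) (hRt : Rp ≤ Rt) :
    Win G φ w₀ (P.Q 0 ∪ (P.BtwN 0 du ∪ P.Q ((0 : Site 2) + stepVec du))) Rp ⊆ rootUS G φ P w₀ Λ q δc Rt du := by
  intro v hv
  obtain ⟨hd, hφv⟩ := (mem_Win G φ).1 hv
  refine Finset.mem_filter.2 ⟨?_, graphBall_mono G w₀ hRt hd⟩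
  rcases Finset.mem_union.1 hφv with hQ | hE
  · refine Finset.mem_union_left _ ?_
    change v ∈ VWin G φ w₀ (P.Q 0) (Λ.rQ 0 0)
    exact mem_VWin_of_zdAdj hstep hd hQ0 hQ (P.exists_adj_of_mem_Q _ hQ)
  · rcases Finset.mem_union.1 hE with hB' | hQ'
    · refine Finset.mem_union_right _ (Finset.mem_union_left _ ?_)
      change v ∈ VWin G φ w₀ (P.BtwN 0 du) (Λ.rB 0 0 du)
      exact mem_VWin_of_zdAdj hstep hd hB hB' (P.exists_adj_of_mem_BtwN 0 du hB')
    · refine Finset.mem_union_right _ (Finset.mem_union_right _ ?_)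
      change v ∈ VWin G φ w₀ (P.Q ((0 : Site 2) + stepVec du)) (Λ.rQ 0 ((0 : Site 2) + stepVec du))
      exact mem_VWin_of_zdAdj hstep hd hQ1 hQ' (P.exists_adj_of_mem_Q _ hQ')

/-! ## §2 The kit clauses of the root band run -/

/-- **THE KIT CLAUSES OF THE ROOT BAND RUN** (`hkits` of `Skelφ.rootOblS_of_rootRunSG`, every direction): for `k ≤ N` and `j ∈ [j₀, j₁]`,
the per-level kit clause of the window step `k` of `(rootSched P du h, rootWCD … (rootUS …))` under the cut root law, from the Step-I′
certificate at the running density (threshold `1 − δ²` over `StepI.index types Sz Sx Sy`; route extents `[ℓ₀, s₁ + R']` certified along `du.1`,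
band spreads `≤ Wb`), p1-g9's kit / slab / shell constants, the counts, and `r₀ ≤ L' ≤ Rt`.
[cite: KozmaNitzan2024, §4 Lemma 10 Steps III–V (pp. 19–22), Lemma 11 (pp. 22–23), p. 28] -/
theorem hkits_rootSched [Countable V] (hlip : Lip G φ) (hstep : Steps G φ) (hfr : Frames G φ types) (hκ : CylConn G φ types) {Δ : ℕ}
    (hΔ : ∀ v, G.degree v ≤ Δ) {p : unitInterval} (hC : CylSubcritical G φ types p)
    (h : RootBandOK P du s₁ R' ℓ₀ N WM Wb ca cb q' ρ) (hRB : Rt + 1 ≤ Λ.rB 0 0 du) (hRQ : Rt + 1 ≤ Λ.rQ 0 ((0 : Site 2) + stepVec du))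
    {Rlev j₀ j₁ : ℕ} (hRl : Rlev + 1 ≤ R') (hj : j₁ ≤ Rlev)
    -- the Step-I′ certificate at the running density `q`, threshold `1 − δ²`
    {D : StepI.Data V} {off : ℕ} (hD : D.Λ = fatSeqOff hfr hC off) {Sz Sx Sy : Finset ℕ} {δ : ℝ} (hδ : 0 < δ)
    (hin : ∀ i ∈ StepI.index types Sz Sx Sy, 1 - δ ^ 2 < (bondPercolation G q).real (StepI.event G φ D i))
    -- the kit: zone scale, certified extents, half-widths, radii
    {Mz : ℕ} (hMz : Mz ∈ Sz) (hkz : D.k ≤ Mz) {ℓK : Fin 2 → ℕ} (hℓK0 : ∀ I, I = 0 → ℓK I ∈ Sx) (hℓK1 : ∀ I, I = 1 → ℓK I ∈ Sy)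
    {A : Fin 2 → Fin 2 → ℕ} {Rk : Fin 2 → ℕ} (hAw : ∀ I, A I = StepI.widths D.Gb D.Fb I (ℓK I)) (hRk : ∀ I, Rk I = D.R (amax (A I)))
    -- the slab and shell rooms of `kitClause'`, the level window above `T₀`, the near threshold inside the rim
    {ℓs M K Rsd r₀ rs cU L' : ℕ} (hℓs : 1 ≤ ℓs) (hj₀ : tanOff ℓs M ≤ j₀)
    (hA : ∀ i k, A i k ≤ M) (hAℓ : ∀ i, A i (oth i) ≤ ℓs) (hK : ∀ i, ℓs + 1 + A i i + Rk i ≤ K)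
    (hnA : ∀ i, Mz + 1 ≤ A i i) (hnM : Mz ≤ M) (hρK : ∀ i, ℓs + 1 + A i i + (fatRadius hfr hC Mz + off) ≤ K)
    (hR'₁ : cylRadMax G φ types ℓs (ℓs + 2 + 2 * tanOff ℓs M) ≤ Rsd) (hR'₂ : ∀ i, cylRadMax G φ types ℓs (ℓs + 2 + A i i + Rk i) ≤ Rsd)
    (hr₀₁ : ℓs + 1 + tanOff ℓs M + Rsd ≤ r₀) (hr₀₂ : ℓs + 2 + tanOff ℓs M + K ≤ r₀) (hr₀L : r₀ ≤ L') (hLR : L' ≤ Rt)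
    (hrs₁ : ℓs + 2 + tanOff ℓs M + Rsd ≤ rs) (hrs₂ : ℓs + 2 + tanOff ℓs M + K ≤ rs) (hcU : ∀ i, (Δ + 1) ^ Rk i ≤ cU)
    -- the route along `du.1`: certified extents beyond the zone scale, depth, band spread
    (hMℓ : Mz + 1 ≤ ℓ₀) (hSx : du.1 = 0 → ∀ ℓ, ℓ₀ ≤ ℓ → ℓ ≤ s₁ + R' → ℓ ∈ Sx) (hSy : du.1 = 1 → ∀ ℓ, ℓ₀ ≤ ℓ → ℓ ≤ s₁ + R' → ℓ ∈ Sy)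
    (hdepth : ∀ I ℓ, ℓ₀ ≤ ℓ → ℓ ≤ s₁ + R' → 2 * ℓs + 2 + tanOff ℓs M + A I I + D.R (amax (StepI.widths D.Gb D.Fb du.1 ℓ)) ≤ r₀)
    (hWb : ∀ ℓ, ℓ₀ ≤ ℓ → ℓ ≤ s₁ + R' → StepI.widths D.Gb D.Fb du.1 ℓ (oth du.1) ≤ Wb ℓ)
    -- the counts
    {Nc : ℕ} (kk : ℕ) (hN : kk * (Δ + 1) ^ (2 * rs) ≤ Nc)
    (hk : (1 - (q : ℝ) ^ (1 + Δ * ((Δ + 1) ^ Rsd + (tanOff ℓs M + 2)) + ((Δ + 1) ^ Rsd + (tanOff ℓs M + 2)) * cU)) ^ kk ≤ δ)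
    -- the schedule and the chain data
    (Sc : Schedule) (hSc : Sc = rootSched P du h) (Pc : WinChainData V)
    (hPc : Pc = rootWCD G φ w₀ Rt L' Sc Rlev Nc j₀ j₁ (rootUS G φ P w₀ Λ q δc Rt du))
    {k : ℕ} (hkN : k ≤ Sc.N) {j : ℕ} (hjj : j ∈ Finset.Icc Pc.j₀ Pc.j₁) :
    ∃ (σ : SData V) (Szz : Finset V),
      SHyp (Pc.stepL (planarWindowWin hlip w₀ Rt) Sc k) j σ ∧ σ.N ≤ Pc.N ∧
      (1 - (q : ℝ) ^ σ.sB) ^ σ.k ≤ δ ∧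
      Szz ⊆ (Pc.stepL (planarWindowWin hlip w₀ Rt) Sc k).X j ∧ Szz ⊆ (planarWindowWin hlip w₀ Rt).stepD Sc k ∧
      (∀ x ∈ σ.K, ∀ e' ∈ σ.seed x, e' ∉ wireSet (↑Szz : Set V)) ∧ (∀ x ∈ σ.K, σ.face x ⊆ Szz) ∧
      (∀ x ∈ σ.K, 1 - 3 * δ ≤ (prodBernoulli ((⟨cellGeomSG G φ P w₀ Λ, q, δc⟩ : KSchA V ℕ).W0sub G
          (rootUS G φ P w₀ Λ q δc Rt du))).real {ω | ∃ u ∈ σ.face x,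
        1 - δ < (prodBernoulli (pinW ((⟨cellGeomSG G φ P w₀ Λ, q, δc⟩ : KSchA V ℕ).W0sub G (rootUS G φ P w₀ Λ q δc Rt du))
          (wireSet (↑Szz : Set V)) ω)).real
          (⋃ t' ∈ Pc.coreE (planarWindowWin hlip w₀ Rt) Sc k, openConnIn (↑((planarWindowWin hlip w₀ Rt).stepD Sc k) : Set V) u t')}) := by
  subst hPc
  set U' := rootUS G φ P w₀ Λ q δc Rt du with hU'
  set 𝒲 : PlanarWindow (winGraph G w₀ Rt) := planarWindowWin hlip w₀ Rt with h𝒲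
  set Pc := rootWCD G φ w₀ Rt L' Sc Rlev Nc j₀ j₁ U' with hPcdef
  have hN' : Sc.N = N := by rw [hSc]; rfl
  have hR'S : Sc.R' = R' := by rw [hSc]; rfl
  have hkN' : k ≤ N := hN' ▸ hkN
  change j ∈ Finset.Icc j₀ j₁ at hjj
  have hj₁ : j ≤ j₁ := (Finset.mem_Icc.1 hjj).2
  have hjT : tanOff ℓs M ≤ j := hj₀.trans (Finset.mem_Icc.1 hjj).1
  have hjR' : j ≤ Sc.R' := by rw [hR'S]; omega
  have hR : r₀ ≤ Rt := hr₀L.trans hLR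
  -- the levels of step `k` are the window levels over core `k`
  have hL : Pc.stepL 𝒲 Sc k = winLData G φ w₀ Rt (Sc.lo k) (Sc.hi k) w₀ U' := rfl
  have hDreg : 𝒲.stepD Sc k = Win G φ w₀ (Sc.region k) Rt := rfl
  -- the region is a subbox of the window graph under the cut root law; the level lies in the region; the level box is wide
  have hWD : IsSubbox (winGraph G w₀ Rt) ((⟨cellGeomSG G φ P w₀ Λ, q, δc⟩ : KSchA V ℕ).W0sub G U') q (𝒲.stepD Sc k) := by
    rw [h𝒲, hSc]; exact isSubbox_rootSched hlip hstep h hRB hRQ hkN'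
  have hXD : winLevel G φ w₀ Rt (Sc.lo k) (Sc.hi k) j ⊆ 𝒲.stepD Sc k := by
    rw [hDreg]; exact Win_mono G φ (Sc.level_subset_region hkN hjR') le_rfl
  have hwide : ∀ i, (Sc.lo k - (j : Site 2)) i + 2 * tanOff ℓs M ≤ (Sc.hi k + (j : Site 2)) i := by
    intro i
    have hle := (Finset.nonempty_Icc.1 (Sc.core_nonempty (k := k) (by omega))) i
    have hj' : ((tanOff ℓs M : ℕ) : ℤ) ≤ j := by exact_mod_cast hjT
    simp only [Pi.sub_apply, Pi.add_apply, Pi.natCast_apply]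
    linarith
  -- the enlarged target: true target over core (k+1), rim = the region's window vertices deeper than `Rt − L'`
  have hPT : Win G φ w₀ (Sc.core (k + 1)) Rt ⊆ Pc.coreE 𝒲 Sc k := Finset.subset_union_left
  have hPD : Win G φ w₀ (Sc.region k) Rt ⊆ 𝒲.stepD Sc k := by rw [hDreg]
  have hfarT : ∀ x ∈ outerBoundary (winGraph G w₀ Rt) (winLevel G φ w₀ Rt (Sc.lo k) (Sc.hi k) j),
      inNbr G φ w₀ Rt (Finset.Icc (Sc.lo k - (j : Site 2)) (Sc.hi k + (j : Site 2))) x ∉ graphBall G w₀ (Rt - r₀) →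
      inNbr G φ w₀ Rt (Finset.Icc (Sc.lo k - (j : Site 2)) (Sc.hi k + (j : Site 2))) x ∈ Pc.coreE 𝒲 Sc k := by
    intro x hx hfar
    refine Finset.mem_union_right _ (Finset.mem_filter.2 ⟨?_, fun hB => hfar (graphBall_mono G w₀ (by omega) hB)⟩)
    exact Win_mono G φ (Sc.level_subset_region hkN hjR') le_rfl (inNbr_mem_Win hx)
  -- the planar room of the level: the schedule's route property
  have hRl' : Pc.Rlev + 1 ≤ Sc.R' := by rw [hR'S]; exact hRl
  have hroom := Pc.roomS Sc hRl' hj hkN j hj₁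
  have hax : Sc.ax k = du.1 := by rw [hSc]; rfl
  have hWbS : Sc.Wb k = Wb := by rw [hSc]; rfl
  have hℓ₀S : Sc.ℓ₀ = ℓ₀ := by rw [hSc]; rfl
  have hℓ₁S : Sc.ℓ₁ = s₁ + R' := by rw [hSc]; rfl
  rw [hax, hWbS, hℓ₀S, hℓ₁S] at hroom
  rw [hL]
  exact kitClause_stepI hlip hstep hfr hκ hΔ hC hD hδ hin hMz hkz hℓK0 hℓK1 hAw hRk hℓs hwide hA hAℓ hK hnA hnM hρK hR'₁ hR'₂ hr₀₁ hr₀₂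
    hR hrs₁ hrs₂ hcU du.1 hMℓ hSx hSy hdepth hWb hroom kk w₀ U' hWD hXD hPD hPT hfarT hN hk

/-! ## §3 The first-hop link of the root band run from the Step-I′ certificate -/

/-- **THE FIRST HOP OF THE ROOT BAND RUN FROM THE STEP-I′ CERTIFICATE** (direction `du`, transverse centre `cb = 0`): the Step-I′ side
input `(c, ℓ1, some (du.1, sgOf du, +1))` at the end `c` of the wired walk over `x₀ = rootCtr du (ca − ℓ1) 0` (file 4's `root_hsrcSG`):
its seed `D.Λ c D.k ⊆ Win w₀ (P.Q 0) R₀`, its band rectangle inside the cut root world, its landing side-half on the start row `core 0`.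
Output: a first-hop set `B₀ ⊆ Win w₀ (core 0) Rt` with `1 − δ₁ < P_{W0sub (rootUS)}(⋃_{t ∈ B₀} w₀ ↔ t)` (threshold `1 − δ₁` of the certificate; the `hB₀`/`hsrc` of
`rootOblS_of_rootRunSG` with `Bpl := core 0`). [cite: KozmaNitzan2024, §4 p. 28 ((32) at the root), Lemma 9 (p. 16), Lemma 11 (p. 23)] -/
theorem root_hsrc_stepI [Countable V] (hstep : Steps G φ) (hfr : Frames G φ types) {p : unitInterval} (hC : CylSubcritical G φ types p)
    (hφ : φ w₀ = 0) (h : RootBandOK P du s₁ R' ℓ₀ N WM Wb ca 0 q' ρ)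
    -- the Step-I′ certificate at the running density `q`, threshold `1 − δ²`
    {D : StepI.Data V} {off : ℕ} (hD : D.Λ = fatSeqOff hfr hC off) {Sz Sx Sy : Finset ℕ} {δ₁ : ℝ}
    (hin : ∀ i ∈ StepI.index types Sz Sx Sy, 1 - δ₁ < (bondPercolation G q).real (StepI.event G φ D i))
    -- the first-hop extent, certified along `du.1`, and its planar placement
    {ℓ1 : ℕ} (hℓ1x : du.1 = 0 → ℓ1 ∈ Sx) (hℓ1y : du.1 = 1 → ℓ1 ∈ Sy) (hℓ1ca : (ℓ1 : ℤ) ≤ ca) (hℓ1Q : (ℓ1 : ℤ) ≤ 5 * (P.r du.1 : ℤ))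
    (hcaQ : ca - ℓ1 + D.k ≤ 5 * (P.r du.1 : ℤ)) (hkQ : (D.k : ℤ) ≤ 5 * (P.r (oth du.1) : ℤ))
    (hW₁ : (StepI.widths D.Gb D.Fb du.1 ℓ1 (oth du.1) : ℤ) ≤ q')
    -- depths: the seed window, the band rectangle
    {R₀ Rp : ℕ} (hR₀ : 5 * P.r du.1 + (fatRadius hfr hC D.k + off) ≤ R₀) (hR₀Q : R₀ + 1 ≤ Λ.rQ 0 0) (hR₀t : R₀ ≤ Rt)
    (hRp : 5 * P.r du.1 + D.R (amax (StepI.widths D.Gb D.Fb du.1 ℓ1)) ≤ Rp) (hRpQ : Rp + 1 ≤ Λ.rQ 0 0) (hRpB : Rp + 1 ≤ Λ.rB 0 0 du)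
    (hRpQ' : Rp + 1 ≤ Λ.rQ 0 ((0 : Site 2) + stepVec du)) (hRpt : Rp ≤ Rt) :
    ∃ B₀ : Finset V, B₀ ⊆ Win G φ w₀ ((rootSched P du h).core 0) Rt ∧
      1 - δ₁ < (prodBernoulli ((⟨cellGeomSG G φ P w₀ Λ, q, δc⟩ : KSchA V ℕ).W0sub G (rootUS G φ P w₀ Λ q δc Rt du))).real
        (⋃ t ∈ B₀, openConn w₀ t) := by
  set S : KSchA V ℕ := ⟨cellGeomSG G φ P w₀ Λ, q, δc⟩ with hSdef
  set U' := rootUS G φ P w₀ Λ q δc Rt du with hU'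
  set aw : Fin 2 → ℕ := StepI.widths D.Gb D.Fb du.1 ℓ1 with haw
  set Rr : ℕ := D.R (amax aw) with hRr
  set x₀ : Site 2 := rootCtr du (ca - ℓ1) 0 with hx₀
  have hr0 : (0 : ℤ) ≤ P.r du.1 := by positivity
  have hr1 : (1 : ℤ) ≤ P.r (oth du.1) := by exact_mod_cast P.one_le_r (oth du.1)
  have hk0 : (0 : ℤ) ≤ D.k := by positivity
  have hσσ : sgOf du * sgOf du = 1 := by rcases sgOf_sign du with hs | hs <;> simp [hs]
  have hq'5 : q' ≤ 5 * (P.r (oth du.1) : ℤ) - 1 := by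
    have hρ := h.hρ; have htr := h.htr; have hW0 : (0 : ℤ) ≤ WM := by positivity
    have hNR : (0 : ℤ) ≤ ((N : ℤ) + 1) * R' := by positivity
    rw [abs_zero, zero_add] at htr
    linarith
  have hca25 : ca ≤ 25 * (P.r du.1 : ℤ) := by
    have hhi := h.hhi; have hs0 : (0 : ℤ) ≤ ((N : ℤ) + 1) * s₁ := by positivity
    linarith
  -- the planar centre lies in the root cube, at ℓ¹-distance `ca − ℓ1 ≤ 5 r∥`
  have hx₀a : x₀ du.1 = sgOf du * (ca - ℓ1) := rootCtr_fst
  have hx₀b : x₀ (oth du.1) = 0 := rootCtr_oth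
  have hx₀Q : x₀ ∈ P.Q 0 := by
    rw [PCells2.Q, PCells2.mem_abox_iff]
    intro i
    simp only [PCells2.cen_zero, Pi.zero_apply]
    push_cast
    by_cases hi : i = du.1
    · subst hi; rw [hx₀a]; rcases sgOf_sign du with hs | hs <;> rw [hs] <;> constructor <;> linarith
    · rw [eq_oth_of_ne hi, hx₀b]; constructor <;> linarith
  have hnorm : (x₀ 0).natAbs + (x₀ 1).natAbs ≤ 5 * P.r du.1 := by
    have ha : (x₀ du.1).natAbs ≤ 5 * P.r du.1 := by
      have : |x₀ du.1| ≤ 5 * (P.r du.1 : ℤ) := by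
        rw [hx₀a, abs_mul, (by rcases sgOf_sign du with hs | hs <;> simp [hs] : |sgOf du| = 1), one_mul, abs_le]
        constructor <;> linarith
      rw [← Int.natCast_natAbs] at this; exact_mod_cast this
    have hb : (x₀ (oth du.1)).natAbs = 0 := by rw [hx₀b]; rfl
    have key : (x₀ 0).natAbs + (x₀ 1).natAbs = (x₀ du.1).natAbs + (x₀ (oth du.1)).natAbs := by
      rcases du with ⟨i, b⟩
      fin_cases i <;> simp [oth, Nat.add_comm]
    rw [key, hb, add_zero]; exact ha
  have hn : (x₀ 0).natAbs + (x₀ 1).natAbs ≤ R₀ := hnorm.trans (le_trans (Nat.le_add_right _ _) hR₀)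
  have hWU : Win G φ w₀ (P.Q 0) R₀ ⊆ U' := Win_Q_subset_rootUS hstep hR₀Q hR₀t
  -- the input at any centre `c` over `x₀` within `‖x₀‖₁` of `w₀`: seed inside the root-cube window, band rectangle inside the cut root world
  have hlink : ∀ c, φ c = x₀ → c ∈ graphBall G w₀ ((x₀ 0).natAbs + (x₀ 1).natAbs) →
      fatSeqOff hfr hC off c D.k ⊆ Win G φ w₀ (P.Q 0) R₀ ∧ rectPrismFin G φ c aw Rr ⊆ U' ∧
      1 - δ₁ < (bondPercolation G q).real (linkIn (↑(rectPrismFin G φ c aw Rr) : Set V) (fatSeqOff hfr hC off c D.k)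
        (rhalf G φ c aw Rr du.1 (sgOf du) 1)) := by
    intro c hφc hcb
    have hcb' : c ∈ graphBall G w₀ (5 * P.r du.1) := graphBall_mono G w₀ hnorm hcb
    refine ⟨fun v hv => ?_, fun v hv => ?_, ?_⟩
    · -- the seed `fatSeqOff off c D.k` lies in the root-cube window of depth `R₀`
      have hv' := cylBall_subset_prism G φ c _ _ ((mem_fatSeqOff_iff hfr hC off).1 hv)
      rw [mem_prism] at hv'
      obtain ⟨hvd, hvbox⟩ := hv'
      refine (mem_Win G φ).2 ⟨graphBall_mono G w₀ hR₀ (BoxProdZ2.mem_graphBall_add G hcb' hvd), ?_⟩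
      rw [mem_box] at hvbox
      rw [PCells2.Q, PCells2.mem_abox_iff]
      intro i
      simp only [PCells2.cen_zero, Pi.zero_apply]
      push_cast
      have hvi := hvbox i
      simp only [Pi.sub_apply, hφc] at hvi
      by_cases hi : i = du.1
      · subst hi; rw [hx₀a] at hvi; rcases sgOf_sign du with hs | hs <;> rw [hs] at hvi <;> constructor <;> linarith [hvi.1, hvi.2]
      · rw [eq_oth_of_ne hi] at hvi ⊢; rw [hx₀b] at hvi
        have hri : (P.r (oth du.1) : ℤ) ≤ P.r (oth du.1) := le_rfl
        constructor <;> linarith [hvi.1, hvi.2]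
    · -- the band rectangle lies in the cut root world (levels `[ca − 2ℓ1, ca]`, `|trans| ≤ Wb ℓ1 ≤ 5 r⊥ − 1`, depth `≤ Rp`)
      rw [mem_rectPrismFin] at hv
      obtain ⟨hvc, hvr⟩ := (mem_rectPrism G φ).1 hv
      have hvd : v ∈ graphBall G c Rr := by
        have := cylBall_subset_prism G φ c _ _ hvc
        rw [mem_prism] at this; exact this.1
      refine Win_rootWorld_subset_rootUS hstep hRpQ hRpB hRpQ' hRpt ((mem_Win G φ).2
        ⟨graphBall_mono G w₀ hRp (BoxProdZ2.mem_graphBall_add G hcb' hvd), ?_⟩)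
      rw [mem_abox] at hvr
      have hva := hvr du.1
      have hvb := hvr (oth du.1)
      simp only [Pi.sub_apply, hφc, hx₀a, hx₀b, sub_zero, haw, StepI.widths_self] at hva hvb
      refine mem_rootWorld_of_level P du ?_ ?_ ?_
      · rcases sgOf_sign du with hs | hs <;> rw [hs] at hva ⊢ <;> linarith [hva.1, hva.2, hℓ1ca, hℓ1Q]
      · rcases sgOf_sign du with hs | hs <;> rw [hs] at hva ⊢ <;> linarith [hva.1, hva.2, hℓ1ca, hca25]
      · have : |φ v (oth du.1)| ≤ (StepI.widths D.Gb D.Fb du.1 ℓ1 (oth du.1) : ℤ) := abs_le.2 ⟨by linarith [hvb.1], hvb.2⟩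
        linarith
    · -- the link input at `c`, extent `ℓ1` along `du.1`, half `(sgOf du, +1)`
      obtain ⟨σu, hσu⟩ : ∃ σu : ℤˣ, (σu : ℤ) = sgOf du := by
        rcases sgOf_sign du with hs | hs
        · exact ⟨1, by simp [hs]⟩
        · exact ⟨-1, by simp [hs]⟩
      have hev := link_at_center hfr hC hD hin c du.1 hℓ1x hℓ1y σu 1
      rw [hσu, Units.val_one, hD] at hev
      rw [coe_rectPrismFin]
      exact hev
  obtain ⟨c, hφc, hcb, hlt⟩ := root_hsrcSG hstep hfr hC P w₀ hφ q δc (U' := U') hx₀Q (le_trans (Nat.le_succ _) hR₀Q) hWU hn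
    (off := off) (k := D.k) (δ := δ₁) (fun c => rectPrismFin G φ c aw Rr) (fun c => rhalf G φ c aw Rr du.1 (sgOf du) 1) hlink
  refine ⟨rhalf G φ c aw Rr du.1 (sgOf du) 1, fun w hw => ?_, hlt⟩
  -- the landing side-half lies in the window over the start row `{level = ca, |trans| ≤ q'}`
  obtain ⟨hwP, hwa, hwb⟩ := (mem_rhalf G φ).1 hw
  have hwball : w ∈ graphBall G w₀ Rt := by
    have h1 : w ∈ graphBall G c Rr := rectPrism_subset_graphBall G φ c aw Rr hwP
    exact graphBall_mono G w₀ (le_trans (by omega) (hRp.trans hRpt)) (BoxProdZ2.mem_graphBall_add G (graphBall_mono G w₀ hnorm hcb) h1)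
  refine (mem_Win G φ).2 ⟨hwball, ?_⟩
  rw [rootSched_core_zero, PCells.mem_psBox_iff]
  simp only [rootCtr_fst, rootCtr_oth]
  have hwb' := abs_oth_le_of_mem_rside G φ ((mem_rside G φ).2 ⟨hwP, hwa⟩)
  rw [hφc, hx₀b, sub_zero] at hwb'
  rw [hφc, hx₀a, haw, StepI.widths_self] at hwa
  rw [one_mul, hφc, hx₀b, sub_zero] at hwb
  have hwb'' : |φ w (oth du.1)| ≤ q' := by
    refine le_trans ?_ hW₁
    rw [haw] at hwb'; exact_mod_cast hwb'
  refine ⟨?_, ?_⟩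
  · have : sgOf du * (φ w du.1 - sgOf du * ca) = 0 := by
      have e1 : φ w du.1 = sgOf du * (ca - ℓ1) + sgOf du * ℓ1 := by linarith
      rw [e1, show sgOf du * (ca - ↑ℓ1) + sgOf du * ↑ℓ1 - sgOf du * ca = 0 by ring, mul_zero]
    rw [this, neg_zero]; exact ⟨le_rfl, le_rfl⟩
  · rw [abs_le] at hwb''; constructor <;> linarith [hwb''.1, hwb''.2]

end Skelφ

end Transplant

end Summit.CriticalPhenomena.PercolationContinuityZ3.Theorems

end
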